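import Literature.RepresentationTheory.HeisenbergGroup.RankOneCongruence
import Mathlib.Topology.Algebra.Group.Pointwise
import HarnessLib

/-!
# `K_m`-smoothness of the normalised section over `SL₂(𝒪)` and the topological central extension `S̃p_ψ → SL₂(F)` (MVW Chap. 2 II.1, II.8, II.10)

Rank one, `F` a non-archimedean local field, `(ψ, μ)` an unramified datum (`ψ` of conductor `𝒪`, `μ` self-dual,
`2 ∈ 𝒪ˣ`), `r = localSection μ hd` the normalised section over `K = SL₂(𝒪)` (`RankOneLocalSection`),
`K_m` the principal congruence subgroups (`RankOneCongruence`). We PROVE: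

* §1 the factorisation `k = n(c/a) · m(a) · u(b/a)` of `k = (a b; c d) ∈ SL₂(F)` with `a ≠ 0`, and for
  `k ∈ K_m`, `m ≥ 1`: `|a| = 1`, `c/a, b/a ∈ 𝔭^m`;
* §2 the operators `r(n(s))` (multiplication by `ψ(-½ s u²)`), `r(m(t))` (`f ↦ f(t⁻¹ ·)`), `r(u(s)) =
  r(w) r(n(-s)) r(w)⁻¹` (`s ∈ 𝒪`, `|t| = 1`), identified through the uniqueness of the normalised implementer;
* §3 **every `f ∈ 𝒮(F)` is fixed by `r(K_m)` for `m` large** (`exists_forall_localSection_apply_eq`): `n(s)`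
  acts trivially once `𝔭^{2N} s u² ⊆ 𝒪` on the support `𝔭^{-N}` of `f`, `m(t)` once `t ≡ 1 mod 𝔭^{M+N}`
  (`f` being `𝔭^M`-invariant), and `u(s)` by the same argument applied to `r(w)⁻¹ f`;
* §4 consequences for the metaplectic-type group `S̃p_ψ` with its smooth-vector topology (`MetaplecticTopology`):
  `r(K_m)`-lifts fill out the basic neighbourhoods (`map_liftK_congruenceSp₁ : liftK(K_m) = U_{m,{1_𝒪}}`), every
  `U_{m,A}` contains some `liftK(K_{m'})`, **`liftK : SL₂(𝒪) → S̃p_ψ` is continuous** and **the `liftK(K_m)`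
  form a basis of neighbourhoods of `1` in `S̃p_ψ`** — i.e. over `SL₂(𝒪)` the topology of `S̃p_ψ` is that of
  `SL₂(𝒪)` (MVW II.10: the covering splits over `K` as topological groups).

**Part II — `S̃p_ψ → SL₂(F)` is a topological central extension by a discrete `ℂˣ`, split over `SL₂(𝒪)`**
(MVW Chap. 2 II.1 (B), II.10). With `S̃p_ψ = MpPsi ρ_ψ ⊆ SL₂(F) × GL(𝒮(F))` (MVW II.1) in its smooth-vector
topology (`RankOneCongruence`) we further PROVE:

* II.§1 separation: `⋂_m 𝔭^m = 0`, `⋂_m K_m = 1`, `⋂_{m,A} U_{m,A} = 1`; hence **`S̃p_ψ` is Hausdorff** (`T2Space`);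
* II.§2 **the kernel of `proj : S̃p_ψ → SL₂(F)` (= the scalars `ℂˣ`, `SchrodingerCommutant`) is discrete**;
* II.§3 for an unramified datum `(ψ, μ)`: `proj(liftK(K_m)) = K_m`, `map proj (𝓝 x) = 𝓝 (proj x)`, **`proj` is an
  open quotient map** `S̃p_ψ → SL₂(F)` (continuous, open, surjective — surjectivity = existence of implementers,
  `RankOneGeneration`), so that `1 → ℂˣ → S̃p_ψ → SL₂(F) → 1` is an extension of topological groups, split over
  `K = SL₂(𝒪)` by the continuous homomorphism `liftK` (Part I §4), which is an **open embedding**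
  (`isOpenEmbedding_liftK`: `S̃p_ψ ⊇ liftK(SL₂(𝒪)) ≅ SL₂(𝒪)` as topological groups).
-/

set_option autoImplicit false

noncomputable section

namespace Literature.RepresentationTheory.HeisenbergGroup

open _root_.MeasureTheory Filter
open scoped Topology NNReal
open Literature.NumberTheory.Automorphic
open Literature.NumberTheory.GaloisRepresentations.IsNonarchimedeanLocalField

variable {F : Type*} [Field F] [ValuativeRel F] [TopologicalSpace F] [IsNonarchimedeanLocalField F]

local notation "Sp₁" => symplecticGroup (polar (LinearMap.mul F F))

/-! ## §1 The factorisation `k = n(c/a) m(a) u(b/a)` on `K_m`, `m ≥ 1` -/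

section Algebra

variable [Invertible (2 : F)]

omit [ValuativeRel F] [TopologicalSpace F] [IsNonarchimedeanLocalField F] in
/-- **big-cell-free factorisation**: if `a ≠ 0` then `(a b; c d) = n(c/a) · m(a) · u(b/a)`. [folklore] -/
theorem eq_unip_mul_levi_mul_upper (g : Sp₁) (ha : entryA g ≠ 0) :
    g = unipSp₁ (entryC g / entryA g) * leviSp₁ (Units.mk0 (entryA g) ha) * upperSp₁ (entryB g / entryA g) := by
  have hdet := det_entries g
  apply Subtype.ext; apply LinearEquiv.ext; intro p
  rw [apply_eq_entries, Subgroup.coe_mul, Subgroup.coe_mul, LinearEquiv.mul_apply, LinearEquiv.mul_apply,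
    coe_upperSp₁_apply, coe_leviSp₁_apply, coe_unipSp₁_apply, Units.val_mk0]
  ext
  · simp only
    field_simp
  · simp only
    field_simp
    linear_combination p.2 * hdet

/-- `u(s) ∈ SL₂(𝒪)` for `s ∈ 𝒪`. [folklore] -/
theorem upperSp₁_mem_integralSp₁ {s : F} (hs : s ∈ primePowBall F 0) : upperSp₁ s ∈ integralSp₁ F :=
  (integralSp₁ F).mul_mem ((integralSp₁ F).mul_mem weylSp₁_mem_integralSp₁
    (unipSp₁_mem_integralSp₁ (neg_mem_primePowBall hs))) ((integralSp₁ F).inv_mem weylSp₁_mem_integralSp₁)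

omit [Invertible (2 : F)] in
/-- elements of `𝔭^m`, `m ≥ 1`, have absolute value `< 1`. [folklore] -/
theorem normAbs_lt_one_of_mem {x : F} {m : ℕ} (hm : 1 ≤ m) (hx : x ∈ primePowBall F m) : normAbs F x < 1 := by
  have h := mem_primePowBall_iff.1 (primePowBall_antitone (show (1 : ℤ) ≤ (m : ℤ) by exact_mod_cast hm) hx)
  rw [zpow_one] at h
  exact lt_of_le_of_lt h (inv_residueFieldCard_lt_one (F := F))

omit [Invertible (2 : F)] in
/-- on `K_m`, `m ≥ 1`, the entry `a` is a unit of `𝒪`. [folklore] -/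
theorem normAbs_entryA_eq_one_of_mem {m : ℕ} (hm : 1 ≤ m) {k : Sp₁} (hk : k ∈ congruenceSp₁ F m) :
    normAbs F (entryA k) = 1 :=
  normAbs_entryA_eq_one (congruenceSp₁_le_integralSp₁ m hk) (normAbs_lt_one_of_mem hm hk.2.2.1)

omit [Invertible (2 : F)] in
/-- on `K_m`, `m ≥ 1`, `a ≠ 0`. [folklore] -/
theorem entryA_ne_zero_of_mem {m : ℕ} (hm : 1 ≤ m) {k : Sp₁} (hk : k ∈ congruenceSp₁ F m) : entryA k ≠ 0 := by
  intro h
  have h1 := normAbs_entryA_eq_one_of_mem hm hk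
  rw [h, map_zero] at h1
  exact zero_ne_one h1

omit [Invertible (2 : F)] in
/-- `𝔭^m / 𝒪ˣ ⊆ 𝔭^m`. [folklore] -/
theorem div_mem_of_mem {x a : F} {m : ℕ} (hx : x ∈ primePowBall F m) (ha : normAbs F a = 1) :
    x / a ∈ primePowBall F m := by
  rw [div_eq_mul_inv]
  exact mul_ball_zero_mem hx (mem_ball_zero_of_normAbs_eq_one (normAbs_inv_eq_one ha))

end Algebra

/-! ## §2 The operators `r(n(s))`, `r(m(t))`, `r(u(s))` -/

section Operators

variable [Invertible (2 : F)] [MeasurableSpace F] [BorelSpace F]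
variable {ψ : AddChar F Circle} (μ : Measure F) [μ.IsAddHaarMeasure] (hd : UnramifiedDatum ψ μ)

omit [MeasurableSpace F] [BorelSpace F] in
/-- `u ↦ ½ u (s u)` is continuous. [folklore] -/
theorem continuous_quadForm (s : F) :
    Continuous fun x : F => ⅟(2 : F) * LinearMap.mul F F x (LinearMap.mulLeft F s x) :=
  continuous_const.mul (continuous_id.mul (continuous_const.mul continuous_id))

include hd in
/-- **`r(n(s))` is multiplication by `ψ(-½ s u²)`** (`s ∈ 𝒪`). [cite: MoeglinVignerasWaldspurger1987, Chap. 2 II.10] -/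
theorem localSection_unipSp₁ {s : F} (hs : s ∈ primePowBall F 0) :
    localSection μ hd (unipSp₁ s) = unipotentEquivSB ψ (isLocallyConstant_of_isContinuousNontrivial hd.cont)
      (fun x : F => ⅟(2 : F) * LinearMap.mul F F x (LinearMap.mulLeft F s x)) (continuous_quadForm s) := by
  rw [localSection_apply]
  refine (eq_localSectionFun μ hd (unipSp₁_mem_integralSp₁ hs) ?_ ?_).symm
  · have h := unipotent_mem_MpPsi (LinearMap.mul F F) ψ (isLocallyConstant_of_isContinuousNontrivial hd.cont)
      continuous_mul_left_apply (LinearMap.mulLeft F s) (mul_mulLeft_symm s) (continuous_quadForm s)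
    rwa [mem_MpPsi] at h
  · apply Subtype.ext
    rw [coe_unipotentEquivSB]
    funext u
    rw [unipotentOp_apply, unramifiedVector_apply]
    split_ifs with hu
    · have hq : -(⅟(2 : F) * LinearMap.mul F F u (LinearMap.mulLeft F s u)) ∈ primePowBall F 0 := by
        rw [LinearMap.mul_apply', LinearMap.mulLeft_apply]
        exact neg_mem_primePowBall (mul_mem_ball_zero hd.two_mem (mul_mem_ball_zero hu (mul_mem_ball_zero hs hu)))
      rw [hd.cond.1 _ hq, Circle.coe_one, mul_one]
    · rw [mul_zero]

include hd in
/-- formula: `(r(n(s)) f)(u) = ψ(-½ u s u) f(u)`. [cite: MoeglinVignerasWaldspurger1987, Chap. 2 II.10] -/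
theorem localSection_unipSp₁_apply {s : F} (hs : s ∈ primePowBall F 0) (f : SchwartzBruhat F) (u : F) :
    ((localSection μ hd (unipSp₁ s) f : SchwartzBruhat F) : F → ℂ) u = (ψ (-(⅟(2 : F) * (u * (s * u)))) : ℂ) * (f : F → ℂ) u := by
  rw [localSection_unipSp₁ μ hd hs, coe_unipotentEquivSB, unipotentOp_apply, LinearMap.mul_apply', LinearMap.mulLeft_apply]

include hd in
/-- **`r(m(t)) f = f(t⁻¹ ·)`** (`|t| = 1`). [cite: MoeglinVignerasWaldspurger1987, Chap. 2 II.10] -/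
theorem localSection_leviSp₁ {t : Fˣ} (ht : normAbs F (t : F) = 1) :
    localSection μ hd (leviSp₁ t) = leviEquivSB (LinearEquiv.smulOfUnit t) (continuous_const.mul continuous_id)
      (continuous_const.mul continuous_id) := by
  rw [localSection_apply]
  refine (eq_localSectionFun μ hd (leviSp₁_mem_integralSp₁ ht) ?_ ?_).symm
  · have h := levi_mem_MpPsi (LinearMap.mul F F) ψ (isLocallyConstant_of_isContinuousNontrivial hd.cont)
      continuous_mul_left_apply (LinearEquiv.smulOfUnit t) (LinearEquiv.smulOfUnit t⁻¹)
      (mul_smulOfUnit_smulOfUnit_inv t) (continuous_const.mul continuous_id) (continuous_const.mul continuous_id)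
    rwa [mem_MpPsi] at h
  · apply Subtype.ext
    rw [coe_leviEquivSB]
    funext u
    rw [leviOp_apply, unramifiedVector_apply, unramifiedVector_apply]
    have e : (LinearEquiv.smulOfUnit t).symm u = ((t⁻¹ : Fˣ) : F) * u := rfl
    rw [e, Units.val_inv_eq_inv_val, unit_mul_mem_ball_zero_iff (normAbs_inv_eq_one ht)]

include hd in
/-- formula: `(r(m(t)) f)(u) = f(t⁻¹ u)`. [cite: MoeglinVignerasWaldspurger1987, Chap. 2 II.10] -/
theorem localSection_leviSp₁_apply {t : Fˣ} (ht : normAbs F (t : F) = 1) (f : SchwartzBruhat F) (u : F) :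
    ((localSection μ hd (leviSp₁ t) f : SchwartzBruhat F) : F → ℂ) u = (f : F → ℂ) ((t : F)⁻¹ * u) := by
  rw [localSection_leviSp₁ μ hd ht, coe_leviEquivSB, leviOp_apply]
  have e : (LinearEquiv.smulOfUnit t).symm u = ((t⁻¹ : Fˣ) : F) * u := rfl
  rw [e, Units.val_inv_eq_inv_val]

include hd in
/-- **`r(u(s)) = r(w) r(n(-s)) r(w)⁻¹`** (`s ∈ 𝒪`; `r` is a homomorphism on `SL₂(𝒪)`).
[cite: MoeglinVignerasWaldspurger1987, Chap. 2 II.10] -/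
theorem localSection_upperSp₁ {s : F} (hs : s ∈ primePowBall F 0) :
    localSection μ hd (upperSp₁ s) =
      localSection μ hd weylSp₁ * localSection μ hd (unipSp₁ (-s)) * (localSection μ hd weylSp₁)⁻¹ := by
  have hw : (weylSp₁ : Sp₁) ∈ integralSp₁ F := weylSp₁_mem_integralSp₁
  have hn : unipSp₁ (-s) ∈ integralSp₁ F := unipSp₁_mem_integralSp₁ (neg_mem_primePowBall hs)
  have e : (⟨upperSp₁ s, upperSp₁_mem_integralSp₁ hs⟩ : integralSp₁ F) =
      ⟨weylSp₁, hw⟩ * ⟨unipSp₁ (-s), hn⟩ * ⟨weylSp₁, hw⟩⁻¹ := rfl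
  have h := congrArg (localSectionK μ hd) e
  rwa [map_mul, map_mul, map_inv, localSectionK_apply, localSectionK_apply, localSectionK_apply] at h

end Operators

/-! ## §3 Every Schwartz–Bruhat function is fixed by `r(K_m)`, `m ≫ 0` -/

section Smooth

variable [Invertible (2 : F)] [MeasurableSpace F] [BorelSpace F]
variable {ψ : AddChar F Circle} (μ : Measure F) [μ.IsAddHaarMeasure] (hd : UnramifiedDatum ψ μ)

include hd in
/-- `r(n(s)) f = f` for `s ∈ 𝔭^{2N}` if `f` is supported in `𝔭^{-N}`. [cite: MoeglinVignerasWaldspurger1987, Chap. 2 II.8] -/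
theorem localSection_unipSp₁_apply_eq_self {f : SchwartzBruhat F} {N : ℕ}
    (hf : ∀ u ∉ primePowBall F (-(N : ℤ)), (f : F → ℂ) u = 0) {s : F} (hs : s ∈ primePowBall F ((2 * N : ℕ) : ℤ)) :
    localSection μ hd (unipSp₁ s) f = f := by
  have hs0 : s ∈ primePowBall F 0 := primePowBall_antitone (by positivity) hs
  apply Subtype.ext
  funext u
  rw [localSection_unipSp₁_apply μ hd hs0]
  by_cases hu : u ∈ primePowBall F (-(N : ℤ))
  · have hq : -(⅟(2 : F) * (u * (s * u))) ∈ primePowBall F 0 := by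
      refine neg_mem_primePowBall (ball_zero_mul_mem (m := 0) hd.two_mem ?_)
      have h := mul_mem_primePowBall hu (mul_mem_primePowBall hs hu)
      have e : (-(N : ℤ)) + ((((2 * N : ℕ) : ℤ)) + -(N : ℤ)) = ((0 : ℕ) : ℤ) := by push_cast; ring
      rwa [e] at h
    rw [hd.cond.1 _ hq, Circle.coe_one, one_mul]
  · rw [hf u hu, mul_zero]

include hd in
/-- `r(m(t)) f = f` for `|t| = 1`, `t ≡ 1 mod 𝔭^{M+N}` if `f` is `𝔭^M`-invariant and supported in `𝔭^{-N}`.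
[cite: MoeglinVignerasWaldspurger1987, Chap. 2 II.8] -/
theorem localSection_leviSp₁_apply_eq_self {f : SchwartzBruhat F} {N M : ℕ}
    (hf : ∀ u ∉ primePowBall F (-(N : ℤ)), (f : F → ℂ) u = 0)
    (hfM : ∀ x, ∀ h ∈ primePowBall F (M : ℤ), (f : F → ℂ) (x + h) = (f : F → ℂ) x)
    {t : Fˣ} (ht1 : normAbs F (t : F) = 1) (ht : (t : F) - 1 ∈ primePowBall F ((M + N : ℕ) : ℤ)) :
    localSection μ hd (leviSp₁ t) f = f := by
  have hti : (t : F)⁻¹ ∈ primePowBall F 0 := mem_ball_zero_of_normAbs_eq_one (normAbs_inv_eq_one ht1)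
  have ht' : (t : F)⁻¹ - 1 ∈ primePowBall F ((M + N : ℕ) : ℤ) := by
    have e : (t : F)⁻¹ - 1 = (t : F)⁻¹ * (-((t : F) - 1)) := by
      have ht0 : (t : F) ≠ 0 := t.ne_zero
      field_simp
      ring
    rw [e]
    exact ball_zero_mul_mem hti (neg_mem_primePowBall ht)
  apply Subtype.ext
  funext u
  rw [localSection_leviSp₁_apply μ hd ht1]
  by_cases hu : u ∈ primePowBall F (-(N : ℤ))
  · have e : (t : F)⁻¹ * u = u + ((t : F)⁻¹ - 1) * u := by ring
    rw [e]
    refine hfM u _ ?_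
    have h := mul_mem_primePowBall ht' hu
    have e' : (((M + N : ℕ) : ℤ)) + -(N : ℤ) = (M : ℤ) := by push_cast; ring
    rwa [e'] at h
  · have hu' : (t : F)⁻¹ * u ∉ primePowBall F (-(N : ℤ)) := by
      intro h
      apply hu
      have h' := mul_mem_primePowBall (mem_ball_zero_of_normAbs_eq_one ht1) h
      rwa [zero_add, ← mul_assoc, mul_inv_cancel₀ t.ne_zero, one_mul] at h'
    rw [hf _ hu', hf u hu]

include hd in
/-- `r(u(s)) f = f` for `s ∈ 𝔭^{2N'}` if `r(w)⁻¹ f` is supported in `𝔭^{-N'}`. [cite: MoeglinVignerasWaldspurger1987, Chap. 2 II.8] -/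
theorem localSection_upperSp₁_apply_eq_self {f : SchwartzBruhat F} {N' : ℕ}
    (hf : ∀ u ∉ primePowBall F (-(N' : ℤ)), (((localSection μ hd weylSp₁)⁻¹ f : SchwartzBruhat F) : F → ℂ) u = 0)
    {s : F} (hs : s ∈ primePowBall F ((2 * N' : ℕ) : ℤ)) :
    localSection μ hd (upperSp₁ s) f = f := by
  have hs0 : s ∈ primePowBall F 0 := primePowBall_antitone (by positivity) hs
  rw [localSection_upperSp₁ μ hd hs0, LinearEquiv.mul_apply, LinearEquiv.mul_apply,
    localSection_unipSp₁_apply_eq_self μ hd hf (neg_mem_primePowBall hs)]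
  show (localSection μ hd weylSp₁ * (localSection μ hd weylSp₁)⁻¹) f = f
  rw [mul_inv_cancel]
  rfl

include hd in
/-- **MVW II.8 for `r|_K`: every `f ∈ 𝒮(F)` is fixed by `r(K_m)` for some `m`** (equivalently: the stabiliser of
`f` in `S̃p_ψ` contains the lift of a congruence subgroup). [cite: MoeglinVignerasWaldspurger1987, Chap. 2 II.8] -/
theorem exists_forall_localSection_apply_eq (f : SchwartzBruhat F) :
    ∃ m : ℕ, ∀ k ∈ congruenceSp₁ F m, localSection μ hd k f = f := by
  obtain ⟨n₀, hn₀⟩ := exists_eq_zero_of_notMem_primePowBall f.2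
  obtain ⟨n₁, hn₁⟩ := exists_forall_add_eq_of_mem_schwartzBruhat f.2
  obtain ⟨n₂, hn₂⟩ := exists_eq_zero_of_notMem_primePowBall ((localSection μ hd weylSp₁)⁻¹ f).2
  have hfN : ∀ u ∉ primePowBall F (-(((-n₀).toNat : ℕ) : ℤ)), (f : F → ℂ) u = 0 :=
    fun u hu => hn₀ u fun h => hu (primePowBall_antitone (by omega) h)
  have hfM : ∀ x, ∀ h ∈ primePowBall F ((n₁.toNat : ℕ) : ℤ), (f : F → ℂ) (x + h) = (f : F → ℂ) x :=
    fun x h hh => hn₁ x h (primePowBall_antitone (by omega) hh)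
  have hfN' : ∀ u ∉ primePowBall F (-(((-n₂).toNat : ℕ) : ℤ)),
      (((localSection μ hd weylSp₁)⁻¹ f : SchwartzBruhat F) : F → ℂ) u = 0 :=
    fun u hu => hn₂ u fun h => hu (primePowBall_antitone (by omega) h)
  set N := (-n₀).toNat
  set M := n₁.toNat
  set N' := (-n₂).toNat
  refine ⟨1 + 2 * N + (M + N) + 2 * N', fun k hk => ?_⟩
  have hm : 1 ≤ 1 + 2 * N + (M + N) + 2 * N' := by omega
  have ha1 : normAbs F (entryA k) = 1 := normAbs_entryA_eq_one_of_mem hm hk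
  have ha : entryA k ≠ 0 := entryA_ne_zero_of_mem hm hk
  have hle : ∀ j : ℕ, j ≤ 1 + 2 * N + (M + N) + 2 * N' → ∀ x ∈ primePowBall F ((1 + 2 * N + (M + N) + 2 * N' : ℕ) : ℤ),
      x ∈ primePowBall F (j : ℤ) := fun j hj x hx => primePowBall_antitone (by exact_mod_cast hj) hx
  have hca : entryC k / entryA k ∈ primePowBall F ((2 * N : ℕ) : ℤ) :=
    div_mem_of_mem (hle _ (by omega) _ hk.2.2.1) ha1
  have hba : entryB k / entryA k ∈ primePowBall F ((2 * N' : ℕ) : ℤ) :=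
    div_mem_of_mem (hle _ (by omega) _ hk.2.1) ha1
  have hta : ((Units.mk0 (entryA k) ha : Fˣ) : F) - 1 ∈ primePowBall F ((M + N : ℕ) : ℤ) := by
    rw [Units.val_mk0]; exact hle _ (by omega) _ hk.1
  have ha1' : normAbs F ((Units.mk0 (entryA k) ha : Fˣ) : F) = 1 := by rw [Units.val_mk0]; exact ha1
  have hn0 : unipSp₁ (entryC k / entryA k) ∈ integralSp₁ F :=
    unipSp₁_mem_integralSp₁ (primePowBall_antitone (by positivity) hca)
  have hl0 : leviSp₁ (Units.mk0 (entryA k) ha) ∈ integralSp₁ F := leviSp₁_mem_integralSp₁ ha1'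
  have hu0 : upperSp₁ (entryB k / entryA k) ∈ integralSp₁ F :=
    upperSp₁_mem_integralSp₁ (primePowBall_antitone (by positivity) hba)
  rw [eq_unip_mul_levi_mul_upper k ha, localSection_mul_of_mem μ hd ((integralSp₁ F).mul_mem hn0 hl0) hu0,
    localSection_mul_of_mem μ hd hn0 hl0, LinearEquiv.mul_apply, LinearEquiv.mul_apply,
    localSection_upperSp₁_apply_eq_self μ hd hfN' hba, localSection_leviSp₁_apply_eq_self μ hd hfN hfM ha1' hta,
    localSection_unipSp₁_apply_eq_self μ hd hfN hca]

include hd in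
/-- finite version: a finite set of Schwartz–Bruhat functions is fixed by `r(K_m)` for some `m`.
[cite: MoeglinVignerasWaldspurger1987, Chap. 2 II.8] -/
theorem exists_forall_localSection_apply_eq_finset (A : Finset (SchwartzBruhat F)) :
    ∃ m : ℕ, ∀ k ∈ congruenceSp₁ F m, ∀ f ∈ A, localSection μ hd k f = f := by
  classical
  choose mf hmf using fun f : SchwartzBruhat F => exists_forall_localSection_apply_eq μ hd f
  refine ⟨A.sup mf, fun k hk f hf => hmf f k (congruenceSp₁_antitone (Finset.le_sup hf) hk)⟩

end Smooth

/-! ## §4 Consequences in `S̃p_ψ`: `liftK` is continuous and `liftK(K_m)` is a neighbourhood basis -/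

section Metaplectic

variable [Invertible (2 : F)] [MeasurableSpace F] [BorelSpace F]
variable {ψ : AddChar F Circle} (μ : Measure F) [μ.IsAddHaarMeasure] (hd : UnramifiedDatum ψ μ)

include hd in
/-- **`liftK(K_m) = U_{m,{1_𝒪}}`**: the pairs over `K_m` fixing `1_𝒪` are exactly the lifts `(k, r(k))`, `k ∈ K_m`.
[cite: MoeglinVignerasWaldspurger1987, Chap. 2 II.10] -/
theorem map_liftK_congruenceSp₁ (m : ℕ) :
    ((congruenceSp₁ F m).subgroupOf (integralSp₁ F)).map (liftK μ hd) =
      MpPsi.smoothNhd (rankOneCongruenceBasis F) (rhoPsi hd.cont) m {unramifiedVector F} := by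
  ext p
  rw [Subgroup.mem_map]
  constructor
  · rintro ⟨k, hk, rfl⟩
    rw [Subgroup.mem_subgroupOf] at hk
    refine ⟨hk, fun f hf => ?_⟩
    rw [Finset.mem_singleton] at hf
    subst hf
    exact localSection_unramifiedVector μ hd k.2
  · rintro ⟨hk, hfix⟩
    have hk0 : (p : Sp₁ × (SchwartzBruhat F ≃ₗ[ℂ] SchwartzBruhat F)).1 ∈ integralSp₁ F :=
      congruenceSp₁_le_integralSp₁ m hk
    refine ⟨⟨_, hk0⟩, ?_, ?_⟩
    · rw [Subgroup.mem_subgroupOf]; exact hk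
    · have hp := p.2
      rw [mem_MpPsi] at hp
      have e := eq_localSectionFun μ hd hk0 hp (hfix _ (Finset.mem_singleton_self _))
      apply Subtype.ext
      apply Prod.ext
      · rfl
      · show localSection μ hd _ = _
        rw [localSection_apply, ← e]

include hd in
/-- every basic neighbourhood `U_{m,A}` of `1` in `S̃p_ψ` contains the lift of a congruence subgroup.
[cite: MoeglinVignerasWaldspurger1987, Chap. 2 II.8] -/
theorem exists_liftK_mem_smoothNhd (m : ℕ) (A : Finset (SchwartzBruhat F)) :
    ∃ m' : ℕ, ∀ k : integralSp₁ F, (k : Sp₁) ∈ congruenceSp₁ F m' →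
      liftK μ hd k ∈ MpPsi.smoothNhd (rankOneCongruenceBasis F) (rhoPsi hd.cont) m A := by
  obtain ⟨m₀, hm₀⟩ := exists_forall_localSection_apply_eq_finset μ hd A
  refine ⟨max m m₀, fun k hk => ⟨congruenceSp₁_antitone (le_max_left m m₀) hk, fun f hf => ?_⟩⟩
  exact hm₀ k (congruenceSp₁_antitone (le_max_right m m₀) hk) f hf

include hd in
/-- **the splitting `liftK : SL₂(𝒪) → S̃p_ψ` is continuous** (`SL₂(𝒪) ≤ SL₂(F)` with the congruence topology,
`S̃p_ψ` with its smooth-vector topology). [cite: MoeglinVignerasWaldspurger1987, Chap. 2 II.10] -/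
theorem continuous_liftK : Continuous (liftK μ hd) := by
  refine continuous_of_continuousAt_one (liftK μ hd) ?_
  rw [ContinuousAt, map_one]
  refine (MpPsi.nhds_one_hasBasis (rankOneCongruenceBasis F) (rhoPsi hd.cont)).tendsto_right_iff.2 fun mA _ => ?_
  obtain ⟨m', hm'⟩ := exists_liftK_mem_smoothNhd μ hd mA.1 mA.2
  have h1 : {k : integralSp₁ F | (k : Sp₁) ∈ congruenceSp₁ F m'} ∈ 𝓝 (1 : integralSp₁ F) :=
    ((isOpen_congruenceSp₁ m').preimage continuous_subtype_val).mem_nhds (congruenceSp₁ F m').one_mem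
  exact mem_of_superset h1 fun k hk => hm' k hk

include hd in
/-- **the lifts `liftK(K_m)` form a basis of neighbourhoods of `1` in `S̃p_ψ`**: over `SL₂(𝒪)` the topology of
`S̃p_ψ` is the congruence topology. [cite: MoeglinVignerasWaldspurger1987, Chap. 2 II.10] -/
theorem nhds_one_hasBasis_liftK :
    (𝓝 (1 : MpPsi (rhoPsi hd.cont))).HasBasis (fun _ : ℕ => True)
      fun m => (((congruenceSp₁ F m).subgroupOf (integralSp₁ F)).map (liftK μ hd) : Set (MpPsi (rhoPsi hd.cont))) := by
  refine (MpPsi.nhds_one_hasBasis (rankOneCongruenceBasis F) (rhoPsi hd.cont)).to_hasBasis ?_ fun m _ => ?_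
  · rintro ⟨m, A⟩ -
    obtain ⟨m', hm'⟩ := exists_liftK_mem_smoothNhd μ hd m A
    refine ⟨m', trivial, ?_⟩
    rintro _ ⟨k, hk, rfl⟩
    rw [SetLike.mem_coe, Subgroup.mem_subgroupOf] at hk
    exact hm' k hk
  · refine ⟨(m, {unramifiedVector F}), trivial, ?_⟩
    rw [← map_liftK_congruenceSp₁ μ hd m]

end Metaplectic

/-! # Part II — the topological central extension `S̃p_ψ → SL₂(F)` -/

/-! ## Part II §1 Separation -/

section Separation

/-- `⋂_m 𝔭^m = 0`. [folklore] -/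
theorem eq_zero_of_forall_mem_primePowBall {x : F} (h : ∀ m : ℕ, x ∈ primePowBall F m) : x = 0 := by
  by_contra hx
  have hpos : 0 < normAbs F x := pos_iff_ne_zero.2 ((map_ne_zero (normAbs F)).2 hx)
  obtain ⟨n, hn⟩ := exists_pow_lt_of_lt_one hpos (inv_residueFieldCard_lt_one (F := F))
  have hle := mem_primePowBall_iff.1 (h n)
  rw [zpow_natCast] at hle
  exact lt_irrefl _ (lt_of_le_of_lt hle hn)

/-- `⋂_m K_m = 1`. [folklore] -/
theorem eq_one_of_forall_mem_congruenceSp₁ {g : Sp₁} (h : ∀ m : ℕ, g ∈ congruenceSp₁ F m) : g = 1 := by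
  have ha : entryA g = 1 := sub_eq_zero.1 (eq_zero_of_forall_mem_primePowBall fun m => (h m).1)
  have hb : entryB g = 0 := eq_zero_of_forall_mem_primePowBall fun m => (h m).2.1
  have hc : entryC g = 0 := eq_zero_of_forall_mem_primePowBall fun m => (h m).2.2.1
  have hd : entryD g = 1 := sub_eq_zero.1 (eq_zero_of_forall_mem_primePowBall fun m => (h m).2.2.2)
  apply Subtype.ext; apply LinearEquiv.ext; intro p
  have e1 : ((1 : Sp₁) : (F × F) ≃ₗ[F] (F × F)) p = p := rfl
  rw [apply_eq_entries, ha, hb, hc, hd, e1, one_mul, zero_mul, zero_mul, one_mul, add_zero, zero_add]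

variable [Invertible (2 : F)] {ψ : AddChar F Circle}

/-- `⋂_{m,A} U_{m,A} = 1` in `S̃p_ψ`. [folklore] -/
theorem eq_one_of_forall_mem_smoothNhd (hψ : ψ.IsContinuousNontrivial) {p : MpPsi (rhoPsi hψ)}
    (h : ∀ (m : ℕ) (A : Finset (SchwartzBruhat F)), p ∈ MpPsi.smoothNhd (rankOneCongruenceBasis F) (rhoPsi hψ) m A) :
    p = 1 := by
  apply Subtype.ext
  apply Prod.ext
  · exact eq_one_of_forall_mem_congruenceSp₁ fun m => (h m ∅).1
  · apply LinearEquiv.ext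
    intro f
    exact (h 0 {f}).2 f (Finset.mem_singleton_self f)

/-- `{1} = ⋂_{m,A} U_{m,A}`. [folklore] -/
theorem singleton_one_eq_iInter_smoothNhd (hψ : ψ.IsContinuousNontrivial) :
    ({1} : Set (MpPsi (rhoPsi hψ))) = ⋂ mA : ℕ × Finset (SchwartzBruhat F),
      (MpPsi.smoothNhd (rankOneCongruenceBasis F) (rhoPsi hψ) mA.1 mA.2 : Set (MpPsi (rhoPsi hψ))) := by
  ext p
  rw [Set.mem_singleton_iff, Set.mem_iInter]
  constructor
  · rintro rfl mA
    exact (MpPsi.smoothNhd _ _ mA.1 mA.2).one_mem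
  · intro h
    exact eq_one_of_forall_mem_smoothNhd hψ fun m A => h (m, A)

/-- `{1}` is closed in `S̃p_ψ` (open subgroups are closed). [folklore] -/
theorem isClosed_singleton_one (hψ : ψ.IsContinuousNontrivial) : IsClosed ({1} : Set (MpPsi (rhoPsi hψ))) := by
  rw [singleton_one_eq_iInter_smoothNhd hψ]
  exact isClosed_iInter fun mA => Subgroup.isClosed_of_isOpen _ (isOpen_smoothNhd_rankOne hψ mA.1 mA.2)

/-- **`S̃p_ψ` is Hausdorff**. [cite: MoeglinVignerasWaldspurger1987, Chap. 2 II.1 (B)] -/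
instance instT2SpaceMpPsi {hψ : ψ.IsContinuousNontrivial} : T2Space (MpPsi (rhoPsi hψ)) :=
  (IsTopologicalGroup.t2Space_iff_one_closed).2 (isClosed_singleton_one hψ)

end Separation

/-! ## Part II §2 The kernel of `proj` is discrete -/

section Kernel

variable [Invertible (2 : F)] {ψ : AddChar F Circle}

/-- the kernel of `proj : S̃p_ψ → SL₂(F)` is the group of scalars `ℂˣ` (Schur: `SchrodingerCommutant`).
[cite: MoeglinVignerasWaldspurger1987, Chap. 2 II.1 (2)] -/
theorem ker_proj_rankOne (hψ : ψ.IsContinuousNontrivial) :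
    (MpPsi.proj (rhoPsi hψ)).ker = (MpPsi.ofScalar (rhoPsi hψ)).range :=
  MpPsi.ker_proj_eq_range_ofScalar _ (implementerUniqueUpToScalar_schrodingerSB_rankOne _ _ hψ)

/-- `U_{0,{1_𝒪}}` meets the kernel of `proj` only in `1`. [folklore] -/
theorem eq_one_of_mem_ker_of_mem_smoothNhd (hψ : ψ.IsContinuousNontrivial) {p : MpPsi (rhoPsi hψ)}
    (hp : p ∈ (MpPsi.proj (rhoPsi hψ)).ker)
    (hU : p ∈ MpPsi.smoothNhd (rankOneCongruenceBasis F) (rhoPsi hψ) 0 {unramifiedVector F}) : p = 1 := by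
  rw [ker_proj_rankOne hψ] at hp
  obtain ⟨c, rfl⟩ := hp
  have hc := (MpPsi.ofScalar_mem_smoothNhd_iff (rankOneCongruenceBasis F) (rhoPsi hψ)
    (Finset.mem_singleton_self (unramifiedVector F)) unramifiedVector_ne_zero c).1 hU
  rw [hc, map_one]

/-- **the kernel `ℂˣ` of `proj : S̃p_ψ → SL₂(F)` is discrete**. [cite: MoeglinVignerasWaldspurger1987, Chap. 2 II.1 (B)] -/
instance instDiscreteTopologyKerProj {hψ : ψ.IsContinuousNontrivial} :
    DiscreteTopology (MpPsi.proj (rhoPsi hψ)).ker := by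
  refine discreteTopology_of_isOpen_singleton_one ?_
  have e : ({1} : Set (MpPsi.proj (rhoPsi hψ)).ker) = Subtype.val ⁻¹'
      (MpPsi.smoothNhd (rankOneCongruenceBasis F) (rhoPsi hψ) 0 {unramifiedVector F} : Set (MpPsi (rhoPsi hψ))) := by
    ext p
    rw [Set.mem_singleton_iff, Set.mem_preimage, SetLike.mem_coe]
    constructor
    · rintro rfl
      exact (MpPsi.smoothNhd _ _ 0 _).one_mem
    · intro h
      exact Subtype.ext (eq_one_of_mem_ker_of_mem_smoothNhd hψ p.2 h)
  rw [e]
  exact (isOpen_smoothNhd_rankOne hψ 0 _).preimage continuous_subtype_val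

end Kernel

/-! ## Part II §3 `proj` is an open quotient map (unramified datum) -/

section Quotient

variable [Invertible (2 : F)] [MeasurableSpace F] [BorelSpace F]
variable {ψ : AddChar F Circle} (μ : Measure F) [μ.IsAddHaarMeasure] (hd : UnramifiedDatum ψ μ)

include hd in
/-- `proj(liftK(K_m)) = K_m`. [folklore] -/
theorem proj_image_map_liftK (m : ℕ) :
    MpPsi.proj (rhoPsi hd.cont) '' (((congruenceSp₁ F m).subgroupOf (integralSp₁ F)).map (liftK μ hd) :
      Set (MpPsi (rhoPsi hd.cont))) = (congruenceSp₁ F m : Set Sp₁) := by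
  ext g
  constructor
  · rintro ⟨_, ⟨k, hk, rfl⟩, rfl⟩
    rw [SetLike.mem_coe, Subgroup.mem_subgroupOf] at hk
    exact hk
  · intro hg
    refine ⟨liftK μ hd ⟨g, congruenceSp₁_le_integralSp₁ m hg⟩, ⟨⟨g, _⟩, ?_, rfl⟩, rfl⟩
    rw [SetLike.mem_coe, Subgroup.mem_subgroupOf]
    exact hg

include hd in
/-- `map proj (𝓝 1) = 𝓝 1`. [folklore] -/
theorem map_proj_nhds_one : map (MpPsi.proj (rhoPsi hd.cont)) (𝓝 1) = 𝓝 1 := by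
  refine le_antisymm (continuous_proj_rankOne hd.cont).continuousAt ?_
  rw [((nhds_one_hasBasis_liftK μ hd).map (MpPsi.proj (rhoPsi hd.cont))).ge_iff]
  intro m _
  rw [proj_image_map_liftK μ hd m]
  exact (isOpen_congruenceSp₁ m).mem_nhds (congruenceSp₁ F m).one_mem

include hd in
/-- `map proj (𝓝 x) = 𝓝 (proj x)`. [folklore] -/
theorem map_proj_nhds (x : MpPsi (rhoPsi hd.cont)) :
    map (MpPsi.proj (rhoPsi hd.cont)) (𝓝 x) = 𝓝 (MpPsi.proj (rhoPsi hd.cont) x) := by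
  have e : MpPsi.proj (rhoPsi hd.cont) ∘ (fun y => x * y) =
      (fun g => MpPsi.proj (rhoPsi hd.cont) x * g) ∘ MpPsi.proj (rhoPsi hd.cont) := funext fun y => map_mul _ x y
  rw [← map_mul_left_nhds_one x, Filter.map_map, ← map_mul_left_nhds_one (MpPsi.proj (rhoPsi hd.cont) x),
    ← map_proj_nhds_one μ hd, Filter.map_map, e]
include hd in
/-- **`proj : S̃p_ψ → SL₂(F)` is an open map**. [cite: MoeglinVignerasWaldspurger1987, Chap. 2 II.1 (B)] -/
theorem isOpenMap_proj_rankOne : IsOpenMap (MpPsi.proj (rhoPsi hd.cont)) :=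
  isOpenMap_iff_nhds_le.2 fun x => (map_proj_nhds μ hd x).ge

include hd in
/-- **`proj : S̃p_ψ → SL₂(F)` is an open quotient map** (continuous, open, onto: `S̃p_ψ / ℂˣ ≅ SL₂(F)` as
topological groups). [cite: MoeglinVignerasWaldspurger1987, Chap. 2 II.1 (B)] -/
theorem isOpenQuotientMap_proj_rankOne : IsOpenQuotientMap (MpPsi.proj (rhoPsi hd.cont)) :=
  ⟨proj_surjective_schrodingerSB_rankOne ψ μ hd.cont hd.selfDual, continuous_proj_rankOne hd.cont,
    isOpenMap_proj_rankOne μ hd⟩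

include hd in
/-- **the splitting `liftK : SL₂(𝒪) → S̃p_ψ` is an open embedding of topological groups** (continuous, injective,
inducing, with open image `liftK(SL₂(𝒪))`): `S̃p_ψ ⊇ liftK(SL₂(𝒪)) ≅ SL₂(𝒪)` topologically.
[cite: MoeglinVignerasWaldspurger1987, Chap. 2 II.10] -/
theorem isOpenEmbedding_liftK : Topology.IsOpenEmbedding (liftK μ hd) := by
  have e : (MpPsi.proj (rhoPsi hd.cont) : MpPsi (rhoPsi hd.cont) → Sp₁) ∘ (liftK μ hd) = Subtype.val :=
    funext fun k => rfl
  have hind : Topology.IsInducing (liftK μ hd) := by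
    refine Topology.IsInducing.of_comp (continuous_liftK μ hd) (continuous_proj_rankOne hd.cont) ?_
    rw [e]
    exact Topology.IsInducing.subtypeVal
  have hinj : Function.Injective (liftK μ hd) := fun k k' h => by
    have h' := congrArg (MpPsi.proj (rhoPsi hd.cont)) h
    rw [proj_liftK, proj_liftK] at h'
    exact Subtype.ext h'
  refine ⟨⟨hind, hinj⟩, ?_⟩
  rw [← MonoidHom.coe_range]
  exact isOpen_unramifiedStabilizer μ hd

end Quotient

end Literature.RepresentationTheory.HeisenbergGroup
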